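import Summits.QuantumFields.BalabanUV.T4Continuum.Support.NE9FutureProfileStep

/-!
# NE9FutureProfileEnd — ROUTE R4 «FADING BY EARLE–HAMILTON», THE INSTANCE IN FUTURE-INFLUENCE COORDINATES, PART 2: the END
# `NE9 ∧ FadingMemory` of the orbit of `NE9FutureProfileStep.step` THROUGH the Earle–Hamilton kernel `NE9EarleHamiltonChain` BY NAME,
# EH1's identification of the coordinates, and the room N2♭ in the refuter's letters
# (cell `pub-balaban`, T4-DAG §6 NE9, route R4 of `t4/ROUTES-NE9.md` v4 §L1.0 EH1∕EH4; INTERFACE REQUEST NE9 (R4-3), OWNER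
# `b2b-balaban-t4-ne9-p1` gen 60, CLAIMS.log l.28192 (name suggested there); unit `b2b-balaban-t4-ne9-formalise-leaf-04` gen 45; HOME
# pre-build F-ne9leaf04g45-1 56445b4012700b9d ∕ assembly 27a8eacc2f8b3a1b; imports `NE9FutureProfileStep` ONLY; modifies nothing)

HONEST FRAMING (T4-DAG PAGE 1).  Rung (B)+1 of the FINITE-VOLUME T⁴ programme — NOT infinite volume, NOT a mass gap, NOT the
Clay problem.  NE9 (`T4OutputRate.NE9` ∧ `FadingMemory`) is a cell NEW ESTIMATE, NOT PRINTED in [I] = [Balaban1987RG1] (CMP 109),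
[II] = [Balaban1988RG2Cluster] (CMP 116), and NOT PROVED for Bałaban's E^{(j)} («NE9 ⇐ the named binders»; spine PROVED 0∕9; row NE9
WALLED ON A MODEL, O-NE9-1).  HONEST DEPENDENCY (cell line, verbatim): continuum YM on T⁴ ⇐ BetaPertH ∧ nine spine estimates (0/9
proved); BetaPertH ⇐ (D1) ∧ (D4) ∧ CAP+tail; G-an2-4 gates asym, D1 and NE2/3/4.  `FlowStep.BetaPertH`, (B), (B^μ) do not occur.
This file is GENERIC complex-Banach bookkeeping: it constructs NO object of Bałaban's and discharges NO Bałaban-side hypothesis;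
nothing printed is asserted (ABSOLUTE RULE); no `def … : Prop` hypothesis is minted; 0 sorry.

WHAT THIS FILE DOES.  §7 `ne9_and_fadingMemory_futureInfluence`: the Banach-level binders (B1-size) `MapsTo (Φ k (g k)) (ball 0 r)
(closedBall 0 B₀)`, (B2) `‖J k‖ ≤ τ₀`, the ROOM `ωh·r + τ₀·B₀ ≤ θ·r`, a common initial state of norm `≤ θ·r`, (B3) the 𝔜-level
last-coupling pair with `lam k ≤ ℓ`, (B4) the weighted coordinate read-out `E g U X = Re (coord U X (emb (scale X) g).1)`, and ANY chain
estimate `NE9EarleHamiltonChain.ChainLipschitz (step …) W r θ Cc k` give `NE9 E W κ (prodModuli (cY·Cc·(τ₀ℓ)) (fun _ => k)) ∧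
FadingMemory …` — by `NE9EarleHamiltonChain.ne9_and_fadingMemory_of_chainLipschitz` with `hfac`∕`h0` := `rfl`;
`ne9_and_fadingMemory_futureInfluence_EH`: with (B1-holo) FRÉCHET holomorphy instead of `hchain`, through the KERNEL
`NE9EarleHamiltonChain.chainLipschitz_of_holoSelfMaps` — rate `2θ∕(1+θ)`, constant `cY·(2∕(1−θ))·(τ₀ℓ)`: NO Lipschitz constant of the
step map, no `τ̄`, no margin `R₀ − s₀`, no `hocc`.  §8 `emb_snd_apply_eq_sum`: for `J = injRead Rd …` and `e₀ = 0` the profile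
coordinate of the actual state IS `ωh⁻ⁿ •` the sum over creation steps of the step-`(k+n)` readings of the slices created so far (route
R4 EH1's definition, with the channel's step-sum over creation steps — `ChannelStepSum`, [II] (1.33) p. 9 — written out).  §9: the room
in the refuter's letters (PRICING-NE9 v4 §B): `ωh·r + τ₀·B₀ = (ωh + (1 − ωh)∕s_box)·r`, `s_box := r(1−ωh)∕(τ₀B₀)`, and `θ(s) < 1 ↔ 1 < s`.
«NE9 ⇐ the named binders»: (B1)–(B4) are DISPLAYED; nothing of Bałaban's is discharged here.

References (TYPES ∕ loci only): [EH1970]; [Balaban1988RG2Cluster] CMP **116** (1988) pp. 7–9 (1.23)–(1.36), p. 20 (2.38), p. 21;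
[Balaban1987RG1] CMP **109** (1987) (2.13) p. 268, p. 263, §5 p. 298.  Summits-side NEW work (LEAN PLACEMENT RULE).
-/

noncomputable section

namespace Summit.QuantumFields.BalabanUV.T4Continuum.NE9FutureProfileEnd

open Metric Set
open scoped BigOperators
open Literature.MathematicalPhysics.QuantumFieldTheory.Balaban1983to89.T4OutputRate
open Literature.MathematicalPhysics.QuantumFieldTheory.Balaban1983to89.T4HistoryLipschitzRecursion
  (prodModuli prodModuli_const fadingMemory_geometric)
open Summit.QuantumFields.BalabanUV.T4Continuum.NE9EarleHamiltonChain
open Summit.QuantumFields.BalabanUV.T4Continuum.NE9FutureProfileStep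

variable {𝔜 Pot : Type*} [NormedAddCommGroup 𝔜] [NormedSpace ℂ 𝔜] [NormedAddCommGroup Pot] [NormedSpace ℂ Pot]
variable {W : Set (ℕ → ℝ)} {Φ : ℕ → ℝ → Pot → 𝔜} {J : ℕ → (𝔜 →L[ℂ] Fut W Pot)} {τ₀ ωh : ℝ}

/-! ## §7 THE END OF ROUTE R4 IN FUTURE-INFLUENCE COORDINATES (modulo the chain estimate = the Earle–Hamilton kernel's OUTPUT) -/

/-- **K2♭ — THE INSTANCE, COMPOSED WITH THE SKETCH'S END.**  For the step `S` and the orbit `emb` of §2, the Banach-level binders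
(B1) size on the `r`-ball (holomorphy is NOT needed here — it enters only through `hchain`), (B2) `‖J k‖ ≤ τ₀`, the room
`ωh·r + τ₀·B₀ ≤ θ·r`, a common initial state of norm `≤ θ·r`, (B3) the 𝔜-level last-coupling pair with `lam k ≤ ℓ`, (B4) the
weighted coordinate read-out, and ANY chain estimate `ChainLipschitz S W r θ Cc k` (the Earle–Hamilton kernel gives
`Cc = 2∕(1−θ)`, `k = 2θ∕(1+θ)` from `HoloSelfMaps`, §4) give `NE9 ∧ FadingMemory` with the geometric moduli
`prodModuli (cY·Cc·(τ₀·ℓ)) (fun _ => k)` — by the sketch's PROVED `ne9_and_fadingMemory_of_chainLipschitz` with `hfac`, `h0` by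
`rfl`. [folklore] -/
theorem ne9_and_fadingMemory_futureInfluence {C : Carriers} {Bg : Type} (E : Functional C Bg) (e₀ : 𝔜 × Fut W Pot)
    (coord : Bg → C.Dom → (𝔜 →L[ℂ] ℂ)) {κ cY r B₀ θ Cc kk ℓ : ℝ} {lam : ℕ → ℝ}
    (hr : 0 < r) (hθ1 : θ < 1) (hCc : 0 ≤ Cc) (hkk : 0 < kk) (hℓ : 0 ≤ ℓ) (hcY : 0 ≤ cY) (hτ₀ : 0 ≤ τ₀) (hωh : 0 ≤ ωh)
    (hΦb : ∀ k, ∀ g ∈ W, MapsTo (Φ k (g k)) (ball (0 : Pot) r) (closedBall 0 B₀))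
    (hJ : ∀ k, ‖J k‖ ≤ τ₀) (hθ : ωh * r + τ₀ * B₀ ≤ θ * r) (he₀ : ‖e₀‖ ≤ θ * r)
    (hchain : ChainLipschitz (step W Φ J τ₀ ωh) W r θ Cc kk)
    (hΦlast : ∀ k, ∀ g (hg : g ∈ W), ∀ g' (hg' : g' ∈ W),
      ‖Φ k (g k) ((emb W Φ J τ₀ ωh e₀ k g).2 ⟨0, ⟨g, hg⟩⟩) -
          Φ k (g' k) ((emb W Φ J τ₀ ωh e₀ k g).2 ⟨0, ⟨g', hg'⟩⟩)‖ ≤ lam k * |g k - g' k|)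
    (hlam : ∀ k, lam k ≤ ℓ)
    (hcoord : ∀ U X, ‖coord U X‖ ≤ cY * Real.exp (-(κ * C.d X)))
    (hE : ∀ g ∈ W, ∀ (U : Bg) (X : C.Dom), E g U X = (coord U X (emb W Φ J τ₀ ωh e₀ (C.scale X) g).1).re) :
    NE9 E W κ (prodModuli (cY * Cc * (τ₀ * ℓ)) fun _ => kk) ∧
      FadingMemory (cY * Cc * (τ₀ * ℓ) / kk) kk (prodModuli (cY * Cc * (τ₀ * ℓ)) fun _ => kk) :=
  ne9_and_fadingMemory_of_chainLipschitz E W (step W Φ J τ₀ ωh) (emb W Φ J τ₀ ωh e₀) (lam := fun k => τ₀ * lam k) hr hθ1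
    hCc hkk (mul_nonneg hτ₀ hℓ) hcY (fun j _ hg => mapsTo_step hτ₀ hωh hΦb hJ hθ j hg) hchain (fun _ _ _ => rfl)
    (fun _ _ _ _ => rfl) (fun _ _ => mem_closedBall_zero_iff.mpr he₀) (last_step e₀ hτ₀ hJ hΦlast)
    (fun j => mul_le_mul_of_nonneg_left (hlam j) hτ₀) (read_of_coord E e₀ coord hcoord hE)

/-! ## §8 EH1's identification: the profile coordinate of the orbit IS the up-weighted reading of the slices created so far -/

/-- **EH1 — THE COORDINATES MEAN WHAT THEY SAY.**  For the reading-built injection `J = injRead Rd …` and an initial state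
`e₀ = (y₀, 0)` (a common scale-0 slice — `ScaleZeroFree`; zero in print, (0.23) p. 256 — and the empty profile), the profile coordinate of the actual state after `k` steps, at `n`
steps ahead and comparison couplings `s`, is `ω̂⁻ⁿ •` the SUM over the creation steps `j+1 ≤ k` of the step-`(k+n)` readings of
the slices created so far: `x_k^g (n, s) = ω̂⁻ⁿ · Σ_{j<k} Rd (k+n) (j+1) s F_{j+1}` — route R4 EH1's
`x_k^g(n, s) := ω̂^{−n}·ρ(T (k+n) s (truncScale k (E g)))` with the channel's step-sum over creation steps (`ChannelStepSum`,
[II] (1.33) p. 9) written out; PRICING-NE9 v4 §B P-R4-1 «shift is exact re-indexing». [folklore] -/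
theorem emb_snd_apply_eq_sum (Rd : ℕ → ℕ → (ℕ → ℝ) → (𝔜 →L[ℂ] Pot)) {ω : ℝ} (hτ₀ : 0 ≤ τ₀) (hω : 0 ≤ ω)
    (hωh : 0 < ωh) (hωωh : ω ≤ ωh) (hRd : ∀ (j n : ℕ), ∀ s ∈ W, ‖Rd (j + n) j s‖ ≤ τ₀ * ω ^ n)
    (y₀ : 𝔜) (k : ℕ) {g : ℕ → ℝ} (hg : g ∈ W) (i : Idx W) :
    (emb W Φ (injRead Rd hτ₀ hω hωh hωωh hRd) τ₀ ωh (y₀, 0) k g).2 i =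
      ∑ j ∈ Finset.range k, ((ωh⁻¹ : ℝ) : ℂ) ^ i.n •
        Rd (k + i.n) (j + 1) (i.s : ℕ → ℝ) (newSlice W Φ (injRead Rd hτ₀ hω hωh hωωh hRd) τ₀ ωh (y₀, 0) j g hg) := by
  induction k generalizing i with
  | zero => simp only [emb_zero, BoundedContinuousFunction.coe_zero, Pi.zero_apply, Finset.range_zero, Finset.sum_empty]
  | succ k ih =>
    have hne : (ωh : ℂ) ≠ 0 := by exact_mod_cast hωh.ne'
    have hsc : (ωh : ℂ) * ((ωh⁻¹ : ℝ) : ℂ) ^ (i.n + 1) = ((ωh⁻¹ : ℝ) : ℂ) ^ i.n := by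
      rw [Complex.ofReal_inv, pow_succ', ← mul_assoc, mul_inv_cancel₀ hne, one_mul]
    have hidx : k + (i.n + 1) = k + 1 + i.n := by omega
    rw [emb_succ_snd_apply _ _ hg, ih, injRead_apply, Finset.sum_range_succ, Finset.smul_sum]
    congr 1
    refine Finset.sum_congr rfl fun j _ => ?_
    rw [smul_smul, hsc, hidx]

/-! ## §9 The room N2♭ in the refuter's letters (PRICING-NE9 v4 §B: `s_box := r(1−ω̂)∕(τ₀B₀)`, `θ(s) := ω̂ + (1−ω̂)∕s`) -/

/-- `θ(s_box)·r` IS the room bound: `ω̂·r + τ₀·B₀ = (ω̂ + (1 − ω̂)∕s_box)·r` for `s_box := r(1−ω̂)∕(τ₀B₀)` — so §3–§7 apply with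
`θ := θ(s_box)` exactly (pure algebra). [folklore] -/
theorem room_eq_theta_sbox {r τ₀ B₀ ωh : ℝ} (hr : 0 < r) (hωh : ωh < 1) :
    ωh * r + τ₀ * B₀ = (ωh + (1 - ωh) / (r * (1 - ωh) / (τ₀ * B₀))) * r := by
  have h1 : (1 : ℝ) - ωh ≠ 0 := (sub_pos.mpr hωh).ne'
  field_simp

/-- … and `θ(s) < 1 ↔ 1 < s` (`ω̂ < 1`, `s > 0`): R4 is ALIVE IFF THE BOX HAS SLACK `s_box > 1` (PRICING-NE9 v4 fragility F-R4-1: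
`s_box = 1 ⇒ θ = 1`). [folklore] -/
theorem theta_sbox_lt_one_iff {ωh s : ℝ} (hωh : ωh < 1) (hs : 0 < s) : ωh + (1 - ωh) / s < 1 ↔ 1 < s := by
  have h1 : 0 < 1 - ωh := sub_pos.mpr hωh
  rw [← lt_sub_iff_add_lt', div_lt_iff₀ hs, lt_mul_iff_one_lt_right h1]

/-- SANITY at print's letters ([II] p. 8 l. 9–10 slack `2 ≥ L∕(L−1)`, L = 13: `s_box = 24∕13`, `ω̂ = 1∕13` ⇒ `θ = 15∕26`,
rate `2θ∕(1+θ) = 30∕41`). [folklore] -/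
example : (1 : ℝ) / 13 + (1 - 1 / 13) / (24 / 13) = 15 / 26 ∧ 2 * ((15 : ℝ) / 26) / (1 + 15 / 26) = 30 / 41 := by norm_num


/-! ## §7b The END through the Earle–Hamilton kernel (route R4, complete modulo (B1)–(B4)) -/

/-- **ROUTE R4's END IN FUTURE-INFLUENCE COORDINATES — KERNEL INCLUDED, 0 sorry.**  (B1) Fréchet holomorphy AND size `B₀` of the
new-slice maps `Φ k (g k)` on the `r`-ball of tables, (B2) `‖J k‖ ≤ τ₀`, the room **N2♭** `ω̂·r + τ₀·B₀ ≤ θ·r` with `0 < θ < 1`,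
a common initial state in the `θr`-ball, (B3) the 𝔜-level last-coupling pair (`lam k ≤ ℓ`), (B4) the weighted coordinate
read-out — give `NE9 ∧ FadingMemory` at the PURE-NUMBER rate `2θ∕(1+θ)` with constant `cY·(2∕(1−θ))·(τ₀ℓ)`: the instance
(PART B `holoSelfMaps_step`) feeds the Earle–Hamilton kernel `chainLipschitz_of_holoSelfMaps`, whose output feeds PART B's
`ne9_and_fadingMemory_futureInfluence`.  NO Lipschitz constant of the step map, no `τ̄`, no margin `R₀ − s₀`, no `hocc`. [folklore] -/
theorem ne9_and_fadingMemory_futureInfluence_EH {C : Carriers} {Bg : Type} (E : Functional C Bg) (e₀ : 𝔜 × Fut W Pot)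
    (coord : Bg → C.Dom → (𝔜 →L[ℂ] ℂ)) {κ cY r B₀ θ ℓ : ℝ} {lam : ℕ → ℝ}
    (hr : 0 < r) (hθ0 : 0 < θ) (hθ1 : θ < 1) (hℓ : 0 ≤ ℓ) (hcY : 0 ≤ cY) (hτ₀ : 0 ≤ τ₀) (hωh : 0 ≤ ωh)
    (hΦd : ∀ k, ∀ g ∈ W, DifferentiableOn ℂ (Φ k (g k)) (ball (0 : Pot) r))
    (hΦb : ∀ k, ∀ g ∈ W, MapsTo (Φ k (g k)) (ball (0 : Pot) r) (closedBall 0 B₀))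
    (hJ : ∀ k, ‖J k‖ ≤ τ₀) (hθ : ωh * r + τ₀ * B₀ ≤ θ * r) (he₀ : ‖e₀‖ ≤ θ * r)
    (hΦlast : ∀ k, ∀ g (hg : g ∈ W), ∀ g' (hg' : g' ∈ W),
      ‖Φ k (g k) ((emb W Φ J τ₀ ωh e₀ k g).2 ⟨0, ⟨g, hg⟩⟩) -
          Φ k (g' k) ((emb W Φ J τ₀ ωh e₀ k g).2 ⟨0, ⟨g', hg'⟩⟩)‖ ≤ lam k * |g k - g' k|)
    (hlam : ∀ k, lam k ≤ ℓ)
    (hcoord : ∀ U X, ‖coord U X‖ ≤ cY * Real.exp (-(κ * C.d X)))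
    (hE : ∀ g ∈ W, ∀ (U : Bg) (X : C.Dom), E g U X = (coord U X (emb W Φ J τ₀ ωh e₀ (C.scale X) g).1).re) :
    NE9 E W κ (prodModuli (cY * (2 / (1 - θ)) * (τ₀ * ℓ)) fun _ => 2 * θ / (1 + θ)) ∧
      FadingMemory (cY * (2 / (1 - θ)) * (τ₀ * ℓ) / (2 * θ / (1 + θ))) (2 * θ / (1 + θ))
        (prodModuli (cY * (2 / (1 - θ)) * (τ₀ * ℓ)) fun _ => 2 * θ / (1 + θ)) :=
  ne9_and_fadingMemory_futureInfluence E e₀ coord hr hθ1 (div_nonneg zero_le_two (by linarith))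
    (div_pos (by linarith) (by linarith)) hℓ hcY hτ₀ hωh hΦb hJ hθ he₀
    (chainLipschitz_of_holoSelfMaps hr hθ0 hθ1 (holoSelfMaps_step hτ₀ hωh hΦd hΦb hJ hθ)) hΦlast hlam hcoord hE

/-- SANITY at print's letters (ROUTES-NE9 v3 §L1.0 ∕ PRICING-NE9 v4 §B: `ω̂ = 1∕13`, `τ₀B₀∕r = ½` ⇒ `θ = 15∕26`, rate `30∕41`,
prefactor `2∕(1−θ) = 52∕11`). [folklore] -/
example : (1 : ℝ) / 13 * 1 + 1 / 2 = 15 / 26 * 1 ∧ 2 * ((15 : ℝ) / 26) / (1 + 15 / 26) = 30 / 41 ∧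
    (2 : ℝ) / (1 - 15 / 26) = 52 / 11 := by norm_num


/-! ## §10 NON-VACUITY OF THE WHOLE END: a linear toy on which (B1)–(B4) hold and `ne9_and_fadingMemory_futureInfluence_EH` FIRES -/

section Toy

open Literature.MathematicalPhysics.QuantumFieldTheory.Balaban1983to89.T4HistoryLipschitzRecursion (toyCarriers)

/-- TOY new-slice map on `𝔜 = Pot = ℂ`: `Φ k s P := s + P∕4` (affine, entire). [folklore] -/
def toyΦ : ℕ → ℝ → ℂ → ℂ := fun _ s P => (s : ℂ) + (1 / 4 : ℂ) * P

/-- TOY orbit: window `]0, 1∕8]`, no injection (`J = 0`), `τ₀ = 1∕4`, `ωh = 1∕2`, initial state `0`. [folklore] -/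
abbrev toyEmb : ℕ → (ℕ → ℝ) → ℂ × Fut (Window (1 / 8)) ℂ :=
  emb (Window (1 / 8)) toyΦ (fun _ => 0) (1 / 4) (1 / 2) 0

/-- TOY functional on `toyCarriers`: the real part of the slice coordinate of the orbit (so (B4) holds by `rfl` with
`coord := id`). [folklore] -/
def toyFun : Functional toyCarriers Unit := fun g _ X => (ContinuousLinearMap.id ℂ ℂ (toyEmb X g).1).re

/-- With no injection the profile coordinate of the toy orbit vanishes identically. [folklore] -/
theorem toyEmb_snd (k : ℕ) {g : ℕ → ℝ} (hg : g ∈ Window (1 / 8)) : (toyEmb k g).2 = 0 := by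
  induction k with
  | zero => rfl
  | succ k ih =>
    show (step (Window (1 / 8)) toyΦ (fun _ => 0) (1 / 4) (1 / 2) k g (toyEmb k g)).2 = 0
    rw [step_of_mem hg]
    show ((1 / 2 : ℝ) : ℂ) • shift (Window (1 / 8)) (toyEmb k g).2 +
        (0 : ℂ →L[ℂ] Fut (Window (1 / 8)) ℂ) (toyΦ k (g k) ((toyEmb k g).2 ⟨0, ⟨g, hg⟩⟩)) = 0
    rw [ih, map_zero, smul_zero, zero_add]
    rfl

/-- **NON-VACUITY OF THE END.**  On the toy, (B1)–(B4), the room (`θ = 19∕32`) and the initial state are ALL discharged and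
`ne9_and_fadingMemory_futureInfluence_EH` yields `NE9 ∧ FadingMemory` with a rate `< 1` — the binders are jointly satisfiable
and the END fires. [folklore] -/
example : ∃ (Λ : ℕ → ℕ → ℝ) (C₉ ω : ℝ), NE9 toyFun (Window (1 / 8)) 0 Λ ∧ FadingMemory C₉ ω Λ ∧ ω < 1 := by
  have hW : ∀ g ∈ Window (1 / 8), ∀ k, |g k| ≤ 1 / 8 := fun g hg k => by
    rw [abs_of_pos (mem_window.mp hg k).1]; exact (mem_window.mp hg k).2
  have h := ne9_and_fadingMemory_futureInfluence_EH (𝔜 := ℂ) (Pot := ℂ) (W := Window (1 / 8)) (Φ := toyΦ)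
    (J := fun _ => 0) (τ₀ := 1 / 4) (ωh := 1 / 2) toyFun 0 (fun _ _ => ContinuousLinearMap.id ℂ ℂ)
    (κ := 0) (cY := 1) (r := 1) (B₀ := 3 / 8) (θ := 19 / 32) (ℓ := 1) (lam := fun _ => 1)
    (by norm_num) (by norm_num) (by norm_num) (by norm_num) (by norm_num) (by norm_num) (by norm_num)
    (fun _ _ _ => ((differentiable_const _).add ((differentiable_const _).mul differentiable_id)).differentiableOn)
    (fun k g hg P hP => by
      rw [mem_ball_zero_iff] at hP
      rw [mem_closedBall_zero_iff]
      calc ‖(g k : ℂ) + (1 / 4 : ℂ) * P‖ ≤ ‖(g k : ℂ)‖ + ‖(1 / 4 : ℂ) * P‖ := norm_add_le _ _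
        _ = |g k| + 1 / 4 * ‖P‖ := by rw [Complex.norm_real, Real.norm_eq_abs, norm_mul]; norm_num
        _ ≤ 1 / 8 + 1 / 4 * 1 := add_le_add (hW g hg k) (by gcongr)
        _ = 3 / 8 := by norm_num)
    (fun _ => by rw [norm_zero]; norm_num) (by norm_num) (by rw [norm_zero]; norm_num)
    (fun k g hg g' hg' => by
      change ‖((g k : ℂ) + (1 / 4 : ℂ) * (toyEmb k g).2 ⟨0, ⟨g, hg⟩⟩) -
          ((g' k : ℂ) + (1 / 4 : ℂ) * (toyEmb k g).2 ⟨0, ⟨g', hg'⟩⟩)‖ ≤ 1 * |g k - g' k|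
      simp only [toyEmb_snd k hg, BoundedContinuousFunction.coe_zero, Pi.zero_apply, mul_zero, add_zero]
      rw [← Complex.ofReal_sub, Complex.norm_real, Real.norm_eq_abs, one_mul])
    (fun _ => le_rfl) (fun _ _ => by rw [Real.exp_eq_one_iff _ |>.mpr (by simp), mul_one]; exact ContinuousLinearMap.norm_id_le)
    (fun _ _ _ _ => rfl)
  exact ⟨_, _, _, h.1, h.2, rate_lt_one (by norm_num) (by norm_num)⟩

end Toy

end Summit.QuantumFields.BalabanUV.T4Continuum.NE9FutureProfileEnd

end
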